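import Mathlib
import HarnessLib
import Summits.HubbardSuperconductivity.HubbardSuperconductivity.Theorems.WeakCouplingBCSWcbcsBcsConstructionLadderShellGeometry

/-!
# Crux `WcbcsBcsConstruction` (stmt-HubbardSuperconductivity-2010), line `ladder-scale-certified-chain`:
# the shell geometry of the window for a GENERAL `C²`-small counterterm (function form of stub (R0))

`shellGeometry_band_of_small_C2`: for every `ν ∈ [-9/10, -3/10]`, every scale `Λ ≤ 1/50` and every function
`F : ℝ² → ℝ` that is twice differentiable in the evaluated-`fderiv` form with POINTWISE bounds
`|F|, |∂ᵢF|, |∂ᵢ∂ⱼF| ≤ 1/500` on `ℝ²`, the band `e(p) = -2(cos p₁ + cos p₂) - ν - F(p)` has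
`ShellGeometry e Λ (1/2) 4 (1/25) 3 (1/2)`. The proof of the registered table form (`stub_ladderShellGeometry`,
p138025) only ever used these pointwise values, so this is the same argument with the table replaced by a function;
it is the input a restated (R1) would consume if the frame class of the record is relaxed to `frameDecay 0`
(see the lead's R1 dossier, interface risk 1). Elementary real analysis. [folklore]
-/

noncomputable section

-- the tree's namespace `Summit.<Summit>.<Problem>.Theorems` repeats the summit name by design (D-0017)
set_option linter.dupNamespace false

namespace Summit.HubbardSuperconductivity.HubbardSuperconductivity.Theorems

open Literature.MathematicalPhysics.QuantumLattice Literature.Probability.LatticeModels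

/-- **Shell geometry of the window for a `C²`-small counterterm (function form).** If `F` is differentiable with
`DF(p)v = F₀(p)v₀ + F₁(p)v₁`, `DF₀(p)v = F₀₀(p)v₀ + F₀₁(p)v₁`, `DF₁(p)v = F₁₀(p)v₀ + F₁₁(p)v₁` everywhere and
`|F|, |F₀|, |F₁|, |F₀₀|, |F₁₀|, |F₁₁| ≤ 1/500` pointwise, then for `ν ∈ [-9/10,-3/10]` and `Λ ≤ 1/50` the band
`p ↦ -2(cos p₁ + cos p₂) - ν - F(p)` satisfies `ShellGeometry · Λ (1/2) 4 (1/25) 3 (1/2)`. [folklore] -/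
theorem shellGeometry_band_of_small_C2 {ν : ℝ} (hν : ν ∈ Set.Icc (-(9 : ℝ) / 10) (-(3 : ℝ) / 10))
    {F F₀ F₁ F₀₀ F₀₁ F₁₀ F₁₁ : (Fin 2 → ℝ) → ℝ}
    (hFd : ∀ p, DifferentiableAt ℝ F p) (hF : ∀ p v, fderiv ℝ F p v = F₀ p * v 0 + F₁ p * v 1)
    (hF₀d : ∀ p, DifferentiableAt ℝ F₀ p) (hF₀ : ∀ p v, fderiv ℝ F₀ p v = F₀₀ p * v 0 + F₀₁ p * v 1)
    (hF₁d : ∀ p, DifferentiableAt ℝ F₁ p) (hF₁ : ∀ p v, fderiv ℝ F₁ p v = F₁₀ p * v 0 + F₁₁ p * v 1)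
    (bF : ∀ p, |F p| ≤ 1 / 500) (bF₀ : ∀ p, |F₀ p| ≤ 1 / 500) (bF₁ : ∀ p, |F₁ p| ≤ 1 / 500)
    (bF₀₀ : ∀ p, |F₀₀ p| ≤ 1 / 500) (bF₁₀ : ∀ p, |F₁₀ p| ≤ 1 / 500) (bF₁₁ : ∀ p, |F₁₁ p| ≤ 1 / 500)
    {Λ : ℝ} (hΛ : Λ ≤ 1 / 50) :
    ShellGeometry (fun p : Fin 2 → ℝ => -2 * (Real.cos (p 0) + Real.cos (p 1)) - ν - F p)
      Λ (1 / 2) 4 (1 / 25) 3 (1 / 2) := by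
  intro p _ hpΛ
  -- jets of the band: bare minus counterterm
  have he : ∀ p v, fderiv ℝ (fun p : Fin 2 → ℝ => -2 * (Real.cos (p 0) + Real.cos (p 1)) - ν - F p) p v =
      (fun p => 2 * Real.sin (p 0) - F₀ p) p * v 0 + (fun p => 2 * Real.sin (p 1) - F₁ p) p * v 1 := by
    intro p v
    have h := (fderiv_bareBand ν p).1.hasFDerivAt.fun_sub (hFd p).hasFDerivAt
    rw [h.fderiv, FunLike.coe_sub, Pi.sub_apply, (fderiv_bareBand ν p).2 v, hF p v]
    ring
  have h₀ : ∀ p v, fderiv ℝ (fun p : Fin 2 → ℝ => 2 * Real.sin (p 0) - F₀ p) p v =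
      (fun p => 2 * Real.cos (p 0) - F₀₀ p) p * v 0 + (fun p => 0 - F₀₁ p) p * v 1 := by
    intro p v
    have h := (fderiv_two_mul_sin_coord 0 p).1.hasFDerivAt.fun_sub (hF₀d p).hasFDerivAt
    rw [h.fderiv, FunLike.coe_sub, Pi.sub_apply, (fderiv_two_mul_sin_coord 0 p).2 v, hF₀ p v]
    ring
  have h₁ : ∀ p v, fderiv ℝ (fun p : Fin 2 → ℝ => 2 * Real.sin (p 1) - F₁ p) p v =
      (fun p => 0 - F₁₀ p) p * v 0 + (fun p => 2 * Real.cos (p 1) - F₁₁ p) p * v 1 := by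
    intro p v
    have h := (fderiv_two_mul_sin_coord 1 p).1.hasFDerivAt.fun_sub (hF₁d p).hasFDerivAt
    rw [h.fderiv, FunLike.coe_sub, Pi.sub_apply, (fderiv_two_mul_sin_coord 1 p).2 v, hF₁ p v]
    ring
  have hGeq := gradSq_of_fderiv he p
  have hκeq := levelCurvature_of_fderiv he h₀ h₁ p
  -- the shell pins `S = cos p₀ + cos p₁`
  have hshell := abs_le.1 hpΛ
  have hk' := abs_le.1 (bF p)
  have hSlo : (139 : ℝ) / 1000 ≤ Real.cos (p 0) + Real.cos (p 1) := by
    have := hshell.2; simp only at this; linarith [hν.2]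
  have hShi : Real.cos (p 0) + Real.cos (p 1) ≤ (461 : ℝ) / 1000 := by
    have := hshell.1; simp only at this; linarith [hν.1]
  obtain ⟨hG1, hG2, hGpos, hNpos, hN1, hN2⟩ := shell_jet_bounds (Real.sin_sq_add_cos_sq (p 0))
    (Real.sin_sq_add_cos_sq (p 1)) hSlo hShi (bF₀ p) (bF₁ p) (bF₀₀ p) (bF₁₀ p) (bF₁₁ p) rfl rfl
  refine ⟨?_, ?_, vanHove_dist_of_level hSlo⟩
  · rw [hGeq]; exact ⟨hG1, hG2⟩
  · rw [hκeq]; exact curvature_bounds_of_sq hGpos hNpos hN1 hN2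

/-! ### Generic calculus on `ℝ²`: `fderiv` from `partialD`, smoothness of frames -/

/-- A linear functional on `ℝ²` is determined by its values on the coordinate vectors:
`Df(p) v = ∂₀f(p) v₀ + ∂₁f(p) v₁` (`partialD i f p = Df(p) eᵢ`; no differentiability needed). [folklore] -/
theorem fderiv_apply_eq_partialD (f : (Fin 2 → ℝ) → ℝ) (p v : Fin 2 → ℝ) :
    fderiv ℝ f p v = partialD 0 f p * v 0 + partialD 1 f p * v 1 := by
  have hv : v = v 0 • (Pi.single 0 1 : Fin 2 → ℝ) + v 1 • (Pi.single 1 1 : Fin 2 → ℝ) := by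
    funext i; fin_cases i <;> simp
  conv_lhs => rw [hv]
  simp only [map_add, map_smul, smul_eq_mul, partialD]
  ring

/-- The symmetrised harmonics are smooth. [folklore] -/
theorem contDiff_harmonic (m n : ℕ) : ContDiff ℝ ⊤ (fun p : Fin 2 → ℝ => TrigPolyC4v.harmonic m n p) := by
  unfold TrigPolyC4v.harmonic
  have hc : ∀ (k : ℕ) (i : Fin 2), ContDiff ℝ ⊤ (fun p : Fin 2 → ℝ => Real.cos (k * p i)) := fun k i =>
    Real.contDiff_cos.comp (contDiff_const.mul (contDiff_apply ℝ ℝ i))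
  exact (((hc m 0).mul (hc n 1)).add ((hc n 0).mul (hc m 1))).div_const 2

/-- Frames are smooth functions of the momentum. [folklore] -/
theorem contDiff_frame_eval (K : TrigPolyC4v) : ContDiff ℝ ⊤ (fun p : Fin 2 → ℝ => K.eval p) := by
  simp only [TrigPolyC4v.eval_def]
  refine ContDiff.sum fun m _ => ContDiff.sum fun n _ => contDiff_const.mul (contDiff_harmonic m n)

/-- A partial derivative of a smooth function on `ℝ²` is smooth. [folklore] -/
theorem contDiff_partialD {f : (Fin 2 → ℝ) → ℝ} (hf : ContDiff ℝ ⊤ f) (i : Fin 2) :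
    ContDiff ℝ ⊤ (partialD i f) := by
  have h1 : ContDiff ℝ ⊤ (fderiv ℝ f) := hf.fderiv_right (m := ⊤) le_rfl
  exact h1.clm_apply contDiff_const

/-- **Stub (R0′) — shell geometry of the window for a frame that is `C²`-small AS A FUNCTION** (function form of
the registered (R0); candidate registered signature `stub_ladderShellGeometryFn` for a restated (R1)): for every
`ν ∈ [-9/10, -3/10]`, every frame `K : TrigPolyC4v` whose values and first and second partial derivatives are
pointwise `≤ 1/500` in absolute value, and every `Λ ≤ 1/50`:
`ShellGeometry (renormalisedBandC ν K) Λ (1/2) 4 (1/25) 3 (1/2)`. [cite: FeldmanKnorrerTrubowitz2004, §1] -/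
theorem stub_ladderShellGeometryFn :
    ∀ ν ∈ Set.Icc (-(9:ℝ) / 10) (-(3:ℝ) / 10), ∀ K : TrigPolyC4v,
      (∀ p : Fin 2 → ℝ, |K.eval p| ≤ 1 / 500 ∧ |partialD 0 K.eval p| ≤ 1 / 500 ∧ |partialD 1 K.eval p| ≤ 1 / 500 ∧
        |partialD 0 (partialD 0 K.eval) p| ≤ 1 / 500 ∧ |partialD 0 (partialD 1 K.eval) p| ≤ 1 / 500 ∧
        |partialD 1 (partialD 1 K.eval) p| ≤ 1 / 500) →
      ∀ Λ : ℝ, Λ ≤ 1 / 50 → ShellGeometry (renormalisedBandC ν K) Λ (1 / 2) 4 (1 / 25) 3 (1 / 2) := by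
  intro ν hν K hK Λ hΛ
  have hsm : ContDiff ℝ ⊤ (fun p : Fin 2 → ℝ => K.eval p) := contDiff_frame_eval K
  have hsm' : ContDiff ℝ ⊤ K.eval := hsm
  have h0 : ContDiff ℝ ⊤ (partialD 0 K.eval) := contDiff_partialD hsm' 0
  have h1 : ContDiff ℝ ⊤ (partialD 1 K.eval) := contDiff_partialD hsm' 1
  have hband : renormalisedBandC ν K = fun p : Fin 2 → ℝ =>
      -2 * (Real.cos (p 0) + Real.cos (p 1)) - ν - K.eval p := by
    funext p; rfl
  rw [hband]
  exact shellGeometry_band_of_small_C2 hν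
    (fun p => hsm'.differentiable (by simp) p) (fun p v => fderiv_apply_eq_partialD _ p v)
    (fun p => h0.differentiable (by simp) p) (fun p v => fderiv_apply_eq_partialD _ p v)
    (fun p => h1.differentiable (by simp) p) (fun p v => fderiv_apply_eq_partialD _ p v)
    (fun p => (hK p).1) (fun p => (hK p).2.1) (fun p => (hK p).2.2.1) (fun p => (hK p).2.2.2.1)
    (fun p => (hK p).2.2.2.2.1) (fun p => (hK p).2.2.2.2.2) hΛ

end Summit.HubbardSuperconductivity.HubbardSuperconductivity.Theorems

end
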